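import Literature.Geometry.Symplectic.StandardEnd
import Literature.Geometry.Symplectic.JHolomorphicMap
import Literature.Geometry.Symplectic.GromovR4RelEnd
import Literature.Geometry.Manifold.OpenSubmanifoldMFDeriv
import Mathlib.Geometry.Manifold.MFDeriv.Atlas
import Mathlib.Geometry.Manifold.ContMDiff.Atlas
import Mathlib.Analysis.Calculus.InverseFunctionTheorem.ContDiff
import Mathlib.Topology.Maps.Proper.CompactlyGenerated
import Mathlib.LinearAlgebra.Basis.VectorSpace
import Mathlib.Geometry.Manifold.Instances.Real
import Mathlib.Analysis.Complex.RemovableSingularity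
import Mathlib.Analysis.Normed.Field.Lemmas
import Mathlib.Topology.Homotopy.Equiv

/-!
# The local family of Gromov's pencil of `J`-planes at a member (Gromov 1985, HLS 1997, Wendl)

A NAMED FACT of the theory of `J`-holomorphic curves in almost complex 4-manifolds, in the
"pencil of planes through one point at infinity" form used for manifolds with a STANDARD FLAT END:

* `Literature.Geometry.Symplectic.pencilCoord p x` — the complex flat coordinates
  `(y₀ + i y₁, y₂ + i y₃)`, `y = ι(e x − e p)` (`e = extChartAt (𝓡 4) p`, `ι = inversion`), of a point
  `x ≠ p` of a `4`-manifold `M` charted on `ℝ⁴`; on a punctured chart-ball where an almost complex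
  structure `J` is standard (`⟪Dψ(J v), b⟫ = ω₀(Dψ v, b)`, `ψ = ι ∘ (e − e p)`), `J` is multiplication by
  `i` in these coordinates;
* `Literature.Geometry.Symplectic.IsPencilPlane J u b` — a PENCIL MEMBER of intercept `b`: a proper,
  injective, immersed, non-constant `C^∞` `J`-holomorphic `u : ℂ → M ∖ p` asymptotic at infinity, in
  its canonical parametrisation, to the flat line `w = b` (`z(u ξ) − ξ → 0`, `w(u ξ) → b`);
* `Literature.Geometry.Symplectic.jPlanePencil_localFamily` — **REFUTED AS STATED, deprecated and
  RETIRED from the facts census (verdict clean-up 2026-08-17)**: the first rendering, for EVERY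
  compact `M` (`J` smooth with `J² = −1` on `M ∖ p` and standard on the punctured `ε'`-chart-ball,
  closed `ε'`-ball inside the chart target): every member `u₀` of intercept `b₀` sits in a smooth
  local family `Floc : ball b₀ δ × ℂ → M ∖ p` of members, `Floc b` of intercept `b`, `Floc b₀ = u₀`,
  jointly `C^∞` with everywhere injective differential (EXISTENCE), which is UNIVERSAL: some open
  neighbourhood `V` of the graph of `u₀` and radius `r₀` are such that every member of intercept
  `b ∈ ball b₀ δ` whose graph over `‖ξ‖ ≤ r₀` lies in `V` is `Floc b` (local uniqueness). It omits
  Wendl's hypothesis `[û]·[û] = m` (`= 1` here) and is **false**: the kernel-checked refutation is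
  `Literature.Geometry.Symplectic.not_jPlanePencil_localFamily : ¬ jPlanePencil_localFamily`
  (`JPlanePencilLocalFamilyCounterexample.lean`, p132675; see the erratum). The term is kept
  byte-for-byte under `@[deprecated]` ONLY because that refutation and two superseded Summits-side
  reduction theorems (`substub_localFamilyUniv_of_pencilLocalFamily` in
  `Summits/SmoothPoincare4/SmoothPoincare4/Theorems/SullivanDualWitnessChargeLocalFamilyUniv.lean` and
  `…ReductionV8.lean`, both already re-proved from the corrected fact as `…_homotopySphere`) name it;
  no `jPlanePencil_localFamily_holds` can exist; do not build on it;
* `Literature.Geometry.Symplectic.jPlanePencil_localFamily_homotopySphere` — **the CORRECTED fact —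
  use this** (review-split seat, 2026-08-16): the same statement for `M` a homotopy `4`-sphere
  (`Nonempty (M ≃ₕ S⁴)`, exactly the field `HomotopySphere.nonempty_homotopyEquiv` of the consumers),
  where Wendl's hypothesis `[û]·[û] = 1 = m` holds. It is the old term with ONE extra hypothesis
  inserted after the instance binders (a consumer of the old name switches by supplying
  `S.nonempty_homotopyEquiv`); the former bridging lemma `jPlanePencil_localFamily.homotopySphere`
  (`old → corrected`, vacuous since `old` is false) was removed with the retirement.

**Erratum (2026-08-16, literature-prover audit against the source; evidence file `MISSTATED.md` of
seat `provefact-Literature.Geometry.Symplectic.jPlanePen-398a99c26d`).** `jPlanePencil_localFamily` is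
FALSE as stated. It quantifies over every compact `M`, but Wendl's Prop. 2.53 is for an embedded sphere
with `[û]·[û] = m` = the number of point constraints (here `m = 1`: the point `q_a` at infinity), and for
a general `M` the compactified member has `[û] = ℓ + α` with `α ∈ H₂(M ∖ p) = H₂(M)` and
`[û]·[û] = 1 + α·α`. Counterexample: `M = Bl_{x₀}(ℂ²) ∪ {∞} ≅ ℂP²-bar` (complex blow-up of `ℂ²` at
`x₀ = (0, b₀)`, Wendl §3.1, one-point compactified at the flat end; chart at `p = ∞` given by `ι ∘ π`,
`π` the blow-down), `J` = the complex structure of the blow-up (`= i` in `y = π x` for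
`‖y‖ > R > |b₀|`, so all hypotheses hold). By Liouville applied to the entire map `π ∘ u`, the member
of intercept `b ≠ b₀` is the lifted line `ξ ↦ π⁻¹(ξ, b)` and no other; the proper transform `u₀` of the
line `{w = b₀}` (`u₀ 0 = ((0,b₀),[1:0]) ∈ E`; class `H − E`, self-intersection `0 ≠ 1`) is a member
of intercept `b₀`. Any `Floc` as in the conclusion then has
`Floc b 0 = π⁻¹(0, b) = ((0,b),[0:1]) → ((0,b₀),[0:1]) ≠ u₀ 0` as `b → b₀`, contradicting the joint
continuity of `(b, ξ) ↦ Floc b ξ` at `(b₀, 0)` (in `X̂ = ℂP² # ℂP²-bar` the lines through `q_a`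
degenerate at intercept `b₀` to the nodal curve `(H − E) ∪ E`). CORRECTED STATEMENT (true by Prop. 2.53
with `m = 1` and Thm 2.49 in the end-compactification `X̂ ≅ M # ℂP²`, `H₂(X̂) = ℤℓ`), filed below as
`jPlanePencil_localFamily_homotopySphere` (review-split seat
`rsplit-Literature.Geometry.Symplectic-398a99c26d`, 2026-08-16, source re-read: pp. 64–66, 72–73):
the same term with the extra hypothesis
`Nonempty (ContinuousMap.HomotopyEquiv M (Metric.sphere (0 : EuclideanSpace ℝ (Fin 5)) 1)) →`
inserted after the instance binders `[IsManifold (𝓡 4) ∞ M]`,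
i.e. `M` a homotopy `4`-sphere — exactly `HomotopySphere.nonempty_homotopyEquiv` of the only consumers,
which then instantiate with `S.carrier S.nonempty_homotopyEquiv`. (Wendl's hypothesis itself,
`[û]·[û] = 1`, follows from `H₂(M; ℤ) = 0`; universality then even holds with `V = univ`: two members
with the same intercept are spheres in class `ℓ` tangent at `q_a`, and `1 = ℓ·ℓ ≥ 2` by positivity of
intersections, Thm 2.49, unless they coincide.) **Refuted formally (2026-08-17):**
`Literature.Geometry.Symplectic.not_jPlanePencil_localFamily` (file
`JPlanePencilLocalFamilyCounterexample.lean`, p132675) PROVES `¬ jPlanePencil_localFamily` on exactly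
this counterexample with `b₀ = 0` (`M = Bl₀(ℂ²) ∪ {∞}` built as a three-chart `ChartedSpaceCore`
manifold, `J ≡ i` in the holomorphic charts `(z, s)`, `(t, w)`, `u₀` the proper transform of the
`z`-axis; the members of intercept `b ≠ 0` are pinned down by Liouville applied to `π ∘ u`).
**Retired (verdict clean-up 2026-08-17, source re-read: Prop. 2.53, book pp. 64–65, hypothesis
"`u : S² → M` is an embedded `J`-holomorphic sphere with `[u]·[u] = m ≥ 0`", `m` = the number of
constraint points `p₁, …, p_m ∈ u(S²)`):** the refuted term stays below byte-for-byte, marked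
`@[deprecated]` with a pointer to its refutation and to the corrected fact, only because the
refutation and two superseded Summits-side reduction theorems still name it; it is no longer
literature debt and must not be built on.

Why this WOULD BE the published theorem for `M` a homotopy `4`-sphere. Compactify the END only:
glue to the flat region `{‖y‖ > R}` of `M ∖ p` the complement of a ball in `ℂP²`; the result
`X̂` is an almost complex 4-manifold (`Ĵ = J` on `M ∖ p`, `= i` near the line at infinity `ℓ∞`),
and a pencil member of intercept `b` is exactly (the restriction to `ℂ = S² ∖ ∞` of) an
EMBEDDED `Ĵ`-holomorphic sphere
`û : S² → X̂` in the class of a line, through the point `q_a = [1:0:0] ∈ ℓ∞` common to all the lines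
`{w = b}`, with tangent direction `b` at `q_a`; `[û]·[û] = 1`. Wendl, *Holomorphic Curves in Low
Dimensions* (LNM 2216), Prop. 2.53 with `m = 1` (p. 64–66): such a `û` is Fredholm regular for the
problem constrained at `q_a` (automatic transversality, Thm 2.46 = Hofer–Lizan–Sikorav 1997 Thm 1,
first stated by Gromov 1985, 2.4.A′), a neighbourhood `𝒰` of `û` in the constrained moduli space is a
smooth 2-manifold, every `v ∈ 𝒰` is embedded, two curves of `𝒰` meet only at `q_a`, transversally
(so the intercept = tangent direction at `q_a` is an injective, hence — kernel sections having only the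
simple forced zero at `q_a` — étale, chart of `𝒰`), and the images `v(S²) ∖ q_a` foliate a
neighbourhood of `û(S²) ∖ q_a` (injective differential of `(b, ξ) ↦ Floc b ξ`). The smooth structure
is the one given by the implicit function theorem (Wendl Thm 2.11; McDuff–Salamon 2012, §3.1–3.3):
nearby solutions are unique, which is the universality clause — a member `C⁰`-close to `u₀` on a large
disc with intercept close to `b₀` is `C⁰`-close on all of `S²` (outside the disc both are holomorphic
graphs over the flat `z`-plane with uniformly small tails; maximum principle at `q_a`), hence
`C^∞`-close by interior elliptic regularity (Hummel 1997 III.3.1; tree: `JHolomorphicWeierstrassR4`),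
hence in `𝒰`; the canonical parametrisation (`z(u ξ) − ξ → 0`) removes the `Aut(ℂ)`-ambiguity.
Consumed by crux `WitnessCharge` of summit `SmoothPoincare4` (line `Sketch`, stub
`substub_localFamilyUniv`, which is this fact with `M := Σ` a homotopy 4-sphere) and by
`TameOrBrodyR4` / `GromovRecognitionRelEnd` (same pencil).

Design: stated WITHOUT the end-compactification (no `ℂP²`-gluing of charts is available in the
tree), for a compact `M` (compactness confines proper members to the flat end at infinity; for
non-compact `M` the junk values of `extChartAt` outside its source would void the asymptotic
clauses), with the member predicate spelled through `pencilCoord` exactly as the consumers' Summits-side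
`Ycoord` / `IsPencilMember` (which are these definitions specialised to homotopy spheres, so the
instantiation is by `rfl`). Deliberately NOT here: Fredholm theory, the moduli space as a space, the
statement for spheres with `m ≥ 2` constraints, disjointness of distinct members (Prop. 2.53 (1)),
anything about limits of members (that is `jHolomorphicLimitOfEmbedded_isEmbedded`).

### Proved first steps of the end-compactification (review-split seat `…-71d400b262`, 2026-08-17)

The discharge `jPlanePencil_localFamily_homotopySphere_holds` needs the Fredholm / implicit-function
theory of the linearised Cauchy–Riemann operator (Wendl Thm 2.11, 2.46), the similarity principle and
the intersection theory of `J`-curves (Thm 2.49), none of which the tree or Mathlib has (triage XL; see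
the seat's census). What IS provable now is landed here, bottom-up, as ordinary theorems (no new
facts), in the order of Wendl's proof: **step L1, a member is genuinely holomorphic in the flat
coordinates of the end** —
* `flatCx : ℝ⁴ ≃L[ℝ] ℂ²`, `flatI` (multiplication by `i` on `ℝ⁴`), `inner_flatI_eq_stdSymplecticForm`
  (`⟪i a, c⟫ = ω₀(a, c)`: the standardness clause `⟪Dψ(J v), c⟫ = ω₀(Dψ v, c)` says `Dψ ∘ J = i ∘ Dψ`,
  `eq_flatI_of_inner_eq_stdSymplecticForm`), `pencilCoord_eq_flatCx`;
* `tendsto_val_cocompact_of_proper`, `isCompact_compl_inPuncturedChartBall`,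
  `eventually_inPuncturedChartBall_of_proper`: a proper `u : ℂ → M ∖ p` (`M` compact) tends to `p`
  and eventually enters every punctured chart-ball;
* `hasFDerivAt_extChartAt_comp_val` (chain rule through the ambient chart) and
  `differentiableAt_pencilCoord_comp`: where `J` is standard, a `J`-holomorphic `u` makes
  `ξ ↦ pencilCoord p (u ξ)` complex differentiable;
* for members: `IsPencilPlane.tendsto_nhds`, `IsPencilPlane.eventually_inPuncturedChartBall`,
  `IsPencilPlane.eventually_differentiableAt_pencilCoord`,
  `IsPencilPlane.exists_differentiableOn_pencilCoord` (holomorphic on `{R ≤ ‖ξ‖}`).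
(The Summits-side line `WitnessCharge/Sketch` has its own copies of L1 for homotopy spheres,
`…HelperEndHolomorphic.lean`; these are the Literature-level statements for any compact `M`.)
**Step B, rigidity of the canonical parametrisation** — `IsPencilPlane.isClosedEmbedding` (a member
is a closed embedding), `IsPencilPlane.exists_homeomorph_comp_eq` (members with the same image differ
by a homeomorphism `h` of `ℂ`), `contDiffAt_of_comp_eq_of_injective_mfderiv` (`h` is `C^∞`: inverse
function theorem on a chart expression of the immersion), `fderiv_transition_mul_I` (`h` is
holomorphic), and
**`IsPencilPlane.eq_of_range_eq`: two members with the same image are equal** (`h ξ − ξ → 0` at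
infinity by the asymptotics, so `h = id`), `IsPencilPlane.intercept_eq_of_range_eq`.
**Step L2, removable singularity and decay at infinity** — `analyticAt_update_comp_inv` and
`exists_norm_sub_le_div_norm` (a function holomorphic outside a compact set with a limit `c` at
infinity extends analytically across `η = 1/ξ = 0`, and `‖f ξ − c‖ ≤ C/‖ξ‖`), for members
`IsPencilPlane.analyticAt_fst_pencilCoord_inv`, `…analyticAt_snd_pencilCoord_inv`,
`IsPencilPlane.exists_decay` (`z(u ξ) = ξ + O(1/ξ)`, `w(u ξ) = b + O(1/ξ)`),
`IsPencilPlane.tendsto_fst_pencilCoord_cocompact`.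

### What a discharge still needs (review verdict 2026-08-17: statement correct, XL apex; road map)

Nothing below is asserted; it records, for a future foundations track, the remaining steps of Wendl's
proof with locators VERIFIED in held sources ([W18] = this book, LNM 2216; [W20] = C. Wendl,
*Lectures on Contact 3-Manifolds, Holomorphic Curves and Intersection Theory*, CUP 2020,
doi:10.1017/9781108608954, Appendix B, which proves the local analysis in full):
* **F-a** `∂̄` on the disc has a bounded right inverse `T : L^p(𝔻) → W^{1,p}(𝔻)` (Cauchy transform;
  [W20] Prop. B.10, Prop. B.12) — needs `W^{1,p}(𝔻)` as a Banach space of functions;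
* **F-b** elliptic regularity for `∂̄ f = g` and for linear Cauchy–Riemann type operators on bundles
  ([W20] Prop. B.13, Cor. B.14, Prop. B.15) — the long pole;
* **F-c** local existence and the SIMILARITY PRINCIPLE ([W20] Thm. B.17, Cor. B.18, Thm. B.20,
  Cor. B.21; statement Thm. 1.21): zeros of solutions are isolated of positive order — this also
  discharges the tree debts `jHolomorphicFlat_uniqueContinuation_const` and, with [W20] §B.2–B.3
  (Thm. B.23), `positivityOfIntersections_leafCoordinate`;
* **F-d** Fredholm property and index `χ(S²) + 2c₁` (Riemann–Roch) of Cauchy–Riemann type operators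
  on line bundles over `S²` ([W18] p. 58–59 quotes it; two-disc model with explicit Laurent splitting);
* **F-e** the nonlinear problem in ONE fixed Banach chart around the compactified member `û`
  (`W^{1,p}`, `p > 2`) with Mathlib's `HasStrictFDerivAt.implicitFunction` ([W18] Thm. 2.11);
* **F-f** automatic transversality for an immersed sphere with `c₁(N) = 1` and one constraint
  ([W18] Thm. 2.46, the zero count of pp. 58–59, from F-c and F-d);
* **F-g** smoothness of the evaluation map and "kernel sections vanish only at `q_a`" ⇒ the
  intercept is an étale chart ⇒ the family `Floc` with injective differential ([W18] p. 65);
* **F-h** the end-compactification `X̂ = (M ∖ p) ∪ (ℂP² ∖ B̄)` as a `ChartedSpaceCore` manifold with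
  two extra charts (pattern: `JPlanePencilLocalFamilyCounterexample.lean`), `û` from L1 + L2 above;
  universality WITHOUT homology: the leaf coordinate of a member in the foliation chart of the
  `S²`-family is open or locally constant (F-c), tends to `b` at `∞`, hence is constant, so the
  member has the image of `Floc b` and equals it by step B above.
-/

noncomputable section

open scoped Manifold ContDiff
open Set Filter _root_.Topology

namespace Literature.Geometry.Symplectic

variable {M : Type*} [TopologicalSpace M] [ChartedSpace (EuclideanSpace ℝ (Fin 4)) M] [T1Space M]

/-- **Complex flat coordinates of the end at `p`**: `pencilCoord p x = (y₀ + i y₁, y₂ + i y₃)` with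
`y = ι(e x − e p)`, `e = extChartAt (𝓡 4) p`, `ι = inversion` (`z ↦ z/‖z‖²`). Meaningful on the
punctured chart-balls `InPuncturedChartBall p ε x` (there `x ↦ y` is a diffeomorphism onto
`{‖y‖ > 1/ε}` and a standard `J` reads as multiplication by `i`); junk elsewhere (junk of
`extChartAt` / `inversion 0 = 0`). Gromov's coordinates `y = z a + w a^⊥` of the flat end
(Gromov 1985, 2.4.A′; McDuff–Salamon 2012 §9.4). [cite: Gromov1985, 2.4.A'] -/
def pencilCoord (p : M) (x : punctured p) : ℂ × ℂ :=
  (⟨inversion (extChartAt (𝓡 4) p x.1 - extChartAt (𝓡 4) p p) 0,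
    inversion (extChartAt (𝓡 4) p x.1 - extChartAt (𝓡 4) p p) 1⟩,
   ⟨inversion (extChartAt (𝓡 4) p x.1 - extChartAt (𝓡 4) p p) 2,
    inversion (extChartAt (𝓡 4) p x.1 - extChartAt (𝓡 4) p p) 3⟩)

/-- **A member of Gromov's pencil of `J`-planes, intercept `b`**: an entire `J`-curve
`u : ℂ → M ∖ p` (`IsEntireJCurve`: `C^∞`, non-constant, `du ∘ i = J ∘ du`) which is injective,
immersed (`du(ξ)` injective for every `ξ`), PROPER (preimages of compact sets compact), and asymptotic
at infinity, in its canonical parametrisation, to the flat line `w = b` of the end: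
`(pencilCoord p (u ξ)).1 − ξ → 0` and `(pencilCoord p (u ξ)).2 → b` along `cocompact ℂ`. These are
the planes `û(S² ∖ ∞)` of the embedded `Ĵ`-spheres `û` in the class of a line through one point
`q_a` of the line at infinity of the end-compactification, with tangent direction `b` at `q_a`
(Gromov 1985, 2.4.A′: the pencil of `J`-lines through a point), written without compactifying.
[cite: Gromov1985, 2.4.A'] -/
def IsPencilPlane {p : M}
    (J : ∀ x : punctured p, TangentSpace (𝓡 4) x →L[ℝ] TangentSpace (𝓡 4) x)
    (u : ℂ → punctured p) (b : ℂ) : Prop :=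
  IsEntireJCurve (𝓡 4) J u ∧ Function.Injective u ∧
  (∀ ξ : ℂ, Function.Injective (mfderiv 𝓘(ℝ, ℂ) (𝓡 4) u ξ)) ∧
  (∀ K : Set (punctured p), IsCompact K → IsCompact (u ⁻¹' K)) ∧
  Tendsto (fun ξ : ℂ => (pencilCoord p (u ξ)).1 - ξ) (cocompact ℂ) (𝓝 0) ∧
  Tendsto (fun ξ : ℂ => (pencilCoord p (u ξ)).2) (cocompact ℂ) (𝓝 b)

/-- Unfolding lemma for `pencilCoord` (definitional). [folklore] -/
theorem pencilCoord_def (p : M) (x : punctured p) :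
    pencilCoord p x =
      (⟨inversion (extChartAt (𝓡 4) p x.1 - extChartAt (𝓡 4) p p) 0,
        inversion (extChartAt (𝓡 4) p x.1 - extChartAt (𝓡 4) p p) 1⟩,
       ⟨inversion (extChartAt (𝓡 4) p x.1 - extChartAt (𝓡 4) p p) 2,
        inversion (extChartAt (𝓡 4) p x.1 - extChartAt (𝓡 4) p p) 3⟩) :=
  rfl

/-- Unfolding lemma for `IsPencilPlane` (definitional). [folklore] -/
theorem isPencilPlane_iff {p : M}
    {J : ∀ x : punctured p, TangentSpace (𝓡 4) x →L[ℝ] TangentSpace (𝓡 4) x}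
    {u : ℂ → punctured p} {b : ℂ} :
    IsPencilPlane J u b ↔
      IsEntireJCurve (𝓡 4) J u ∧ Function.Injective u ∧
      (∀ ξ : ℂ, Function.Injective (mfderiv 𝓘(ℝ, ℂ) (𝓡 4) u ξ)) ∧
      (∀ K : Set (punctured p), IsCompact K → IsCompact (u ⁻¹' K)) ∧
      Tendsto (fun ξ : ℂ => (pencilCoord p (u ξ)).1 - ξ) (cocompact ℂ) (𝓝 0) ∧
      Tendsto (fun ξ : ℂ => (pencilCoord p (u ξ)).2) (cocompact ℂ) (𝓝 b) :=
  Iff.rfl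

/-! ### The refuted first rendering (deprecated, retired 2026-08-17) -/

/-- **Refuted as stated — deprecated and RETIRED from the facts census (verdict clean-up
2026-08-17); kept, statement byte-for-byte, only because its refutation
`Literature.Geometry.Symplectic.not_jPlanePencil_localFamily` and two superseded Summits-side
reduction theorems name it. Do not build on it; no `jPlanePencil_localFamily_holds` can exist.**
The record was meant to say (Gromov 1985 2.4.A′ / Hofer–Lizan–Sikorav 1997 Thm 1 / Wendl, LNM 2216,
Prop. 2.53 with `m = 1`, Thm 2.46, Thm 2.11: the local family of the pencil of `J`-planes at a
member — existence AND universality): let `M` be a compact smooth `4`-manifold, `p ∈ M`, `J` an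
almost complex structure on `M ∖ p` (`J² = −1`, smooth in tangent coordinates) which is STANDARD on
the punctured `ε'`-chart-ball at `p` (`⟪Dψ(J v), c⟫ = ω₀(Dψ v, c)`, `ψ = ι ∘ (e − e p)`), with
`closedBall (e p) ε' ⊆ e.target`; then for every pencil member `u₀` of intercept `b₀` there are
`δ > 0` and `Floc : ℂ → ℂ → M ∖ p` with `Floc b₀ = u₀`, `Floc b` a member of intercept `b` for every
`b ∈ ball b₀ δ`, `(b, ξ) ↦ Floc b ξ` of class `C^∞` on `ball b₀ δ × ℂ` with injective differential at
every point, and there are `r₀` and an open `V ⊆ ℂ × (M ∖ p)` containing the graph of `u₀` such that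
every member `u` of intercept `b ∈ ball b₀ δ` with `(ξ, u ξ) ∈ V` for all `‖ξ‖ ≤ r₀` equals `Floc b`.
**What is wrong:** it quantifies over EVERY compact `M`, omitting the hypothesis of the printed
theorem — Wendl, Prop. 2.53 (book p. 64): "`u : S² → M` is an embedded `J`-holomorphic sphere with
`[u]·[u] = m ≥ 0`", `m` the number of constraint points (here `m = 1`, the point `q_a` at infinity)
— which for the end-compactified member `û` reads `[û]·[û] = 1` and fails as soon as
`H₂(M; ℤ) ≠ 0` contributes: on `M = Bl₀(ℂ²) ∪ {∞} ≅ ℂP²-bar` the proper transform of a line through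
the blown-up point is a member of self-intersection `0`, and the members of nearby intercepts
degenerate onto the nodal curve `(H − E) ∪ E`, so no jointly continuous `Floc` through it exists
(module erratum). **Refutation (kernel-checked, kept):**
`Literature.Geometry.Symplectic.not_jPlanePencil_localFamily : ¬ jPlanePencil_localFamily`
(`Literature/Geometry/Symplectic/JPlanePencilLocalFamilyCounterexample.lean`, p132675).
**Corrected statement — use instead:** the named fact
`Literature.Geometry.Symplectic.jPlanePencil_localFamily_homotopySphere` (below: this very term with
the single extra hypothesis `Nonempty (M ≃ₕ S⁴)` inserted after the instance binders, under which
`[û]·[û] = 1 = m` holds; same source and locator). Remaining users of this name: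
the refutation, and `substub_localFamilyUniv_of_pencilLocalFamily` in
`Summits/SmoothPoincare4/SmoothPoincare4/Theorems/SullivanDualWitnessChargeLocalFamilyUniv.lean` /
`…ReductionV8.lean` (append-only Theorems files; both superseded there by
`…_of_pencilLocalFamily_homotopySphere`, proved from the corrected fact).
[cite: Wendl2018, Prop. 2.53 (m = 1), Thm 2.46, Thm 2.11] -/
@[deprecated "refuted as stated (omits Wendl's hypothesis [u]·[u] = m, here = 1; false on CP²-bar): \
  see Literature.Geometry.Symplectic.not_jPlanePencil_localFamily \
  (JPlanePencilLocalFamilyCounterexample.lean); corrected statement: \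
  Literature.Geometry.Symplectic.jPlanePencil_localFamily_homotopySphere (M a homotopy 4-sphere)"
  (since := "2026-08-17")]
def jPlanePencil_localFamily : Prop :=
  ∀ (M : Type) [TopologicalSpace M] [T2Space M] [SecondCountableTopology M] [CompactSpace M]
    [ChartedSpace (EuclideanSpace ℝ (Fin 4)) M] [IsManifold (𝓡 4) ∞ M] (p : M)
    (J : ∀ x : punctured p, TangentSpace (𝓡 4) x →L[ℝ] TangentSpace (𝓡 4) x) (ε' : ℝ),
    0 < ε' →
    Metric.closedBall (extChartAt (𝓡 4) p p) ε' ⊆ (extChartAt (𝓡 4) p).target →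
    (∀ (x : punctured p) (v : TangentSpace (𝓡 4) x), J x (J x v) = -v) →
    (∀ x₀ : punctured p, ContMDiffAt (𝓡 4) 𝓘(ℝ, EuclideanSpace ℝ (Fin 4) →L[ℝ] EuclideanSpace ℝ (Fin 4)) ∞
      (inTangentCoordinates (𝓡 4) (𝓡 4) (id : punctured p → punctured p) id (fun x => J x) x₀) x₀) →
    (∀ x : punctured p, InPuncturedChartBall p ε' x →
      ∀ (v : TangentSpace (𝓡 4) x) (c : EuclideanSpace ℝ (Fin 4)),
        inner ℝ (fderiv ℝ inversion (extChartAt (𝓡 4) p x.1 - extChartAt (𝓡 4) p p)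
          (mfderiv (𝓡 4) 𝓘(ℝ, EuclideanSpace ℝ (Fin 4))
            (fun z : punctured p => extChartAt (𝓡 4) p z.1) x (J x v))) c
        = stdSymplecticForm (fderiv ℝ inversion (extChartAt (𝓡 4) p x.1 - extChartAt (𝓡 4) p p)
          (mfderiv (𝓡 4) 𝓘(ℝ, EuclideanSpace ℝ (Fin 4))
            (fun z : punctured p => extChartAt (𝓡 4) p z.1) x v)) c) →
    ∀ (u₀ : ℂ → punctured p) (b₀ : ℂ), IsPencilPlane J u₀ b₀ →
      ∃ δ : ℝ, 0 < δ ∧ ∃ Floc : ℂ → ℂ → punctured p, Floc b₀ = u₀ ∧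
        (∀ b ∈ Metric.ball b₀ δ, IsPencilPlane J (Floc b) b) ∧
        ContMDiffOn 𝓘(ℝ, ℂ × ℂ) (𝓡 4) ∞ (fun q : ℂ × ℂ => Floc q.1 q.2)
          ((Metric.ball b₀ δ) ×ˢ (univ : Set ℂ)) ∧
        (∀ q : ℂ × ℂ, q.1 ∈ Metric.ball b₀ δ →
          Function.Injective (mfderiv 𝓘(ℝ, ℂ × ℂ) (𝓡 4) (fun q : ℂ × ℂ => Floc q.1 q.2) q)) ∧
        ∃ (r₀ : ℝ) (V : Set (ℂ × punctured p)), IsOpen V ∧ (∀ ξ : ℂ, (ξ, u₀ ξ) ∈ V) ∧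
          ∀ (u : ℂ → punctured p) (b : ℂ), IsPencilPlane J u b → b ∈ Metric.ball b₀ δ →
            (∀ ξ : ℂ, ‖ξ‖ ≤ r₀ → (ξ, u ξ) ∈ V) → u = Floc b

/-! ### The corrected fact: homotopy `4`-spheres (`[û]·[û] = 1`) -/

/-- **Gromov 1985 / Hofer–Lizan–Sikorav 1997 / Wendl, LNM 2216 Prop. 2.53 (`m = 1`) with
Thm 2.49: the local family of the pencil of `J`-planes at a member, for a HOMOTOPY `4`-SPHERE with a
standard flat end — existence AND universality** (the corrected form of `jPlanePencil_localFamily`,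
whose general-`M` version is false, see the module erratum). Let `M` be a compact smooth `4`-manifold
homotopy equivalent to `S⁴` (`Nonempty (M ≃ₕ S⁴)`), `p ∈ M`, `J` an almost complex structure on
`M ∖ p` (`J² = −1`, smooth in tangent coordinates) which is STANDARD on the punctured `ε'`-chart-ball
at `p` (`⟪Dψ(J v), c⟫ = ω₀(Dψ v, c)`, `ψ = ι ∘ (e − e p)`, i.e. `J = ψ^* i` there), with
`closedBall (e p) ε' ⊆ e.target`. Then for every pencil member `u₀` of intercept `b₀`
(`IsPencilPlane J u₀ b₀`) there are `δ > 0` and `Floc : ℂ → ℂ → M ∖ p` with `Floc b₀ = u₀`, `Floc b`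
a member of intercept `b` for every `b ∈ ball b₀ δ`, `(b, ξ) ↦ Floc b ξ` of class `C^∞` on
`ball b₀ δ × ℂ` with injective differential at every point, and there are `r₀` and an open
`V ⊆ ℂ × (M ∖ p)` containing the graph of `u₀` such that every member `u` of intercept
`b ∈ ball b₀ δ` with `(ξ, u ξ) ∈ V` for all `‖ξ‖ ≤ r₀` equals `Floc b`.

How this is the printed theorem. Compactify the flat end only: `X̂ = (M ∖ p) ∪ (ℂP² ∖ B̄(1/ε'))`
glued along `{‖y‖ > 1/ε'}` (so `X̂ ∖ ℓ∞ = M ∖ p`, `X̂ ≅ M # ℂP²`), `Ĵ = J` on `M ∖ p` and `= i` near the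
line at infinity `ℓ∞`. A member `u` of intercept `b` extends (removable singularity — `u` is genuinely
holomorphic in the flat coordinates near `ℓ∞`) to an EMBEDDED `Ĵ`-sphere `û : S² → X̂` with
`û(∞) = q_a` (the point `[1:0:0]` of `ℓ∞`, coordinates `[z : w : x₀]`, common to all the lines
`{w = b}`), transverse to `ℓ∞` there with tangent direction `(1, b)` in the chart `(1/z, w/z)`
(because `z(u ξ) = ξ + O(1/ξ)`, `w(u ξ) → b`); conversely such a sphere restricted to
`S² ∖ û⁻¹(ℓ∞) = ℂ`, in the unique affine reparametrisation with `z(u ξ) − ξ → 0`, is a member of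
intercept `b`. Mayer–Vietoris gives `H₂(X̂; ℤ) = H₂(M ∖ p; ℤ) ⊕ ℤℓ`, and `H₂(M ∖ p) = H₂(M) = 0` for a
homotopy sphere, so `[û] = (û·ℓ) ℓ = ℓ` and `[û]·[û] = 1 = m` with the single constraint `p₁ = q_a`:
the hypothesis of Prop. 2.53 (p. 64). Its conclusions: a neighbourhood `𝒰` of `û` in
`𝓜_{0,1}(Ĵ; q_a)` is a smooth `2`-manifold of embedded curves meeting pairwise only at `q_a`,
transversally (1), whose images minus `q_a` smoothly foliate a neighbourhood of `û(S²) ∖ q_a` (2);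
kernel sections `η ∈ ker D_û^N`, `η(q_a) = 0`, vanish ONLY at `q_a`, simply (p. 65: `c₁(N_û) = m = 1`),
so the tangent direction at `q_a` — the intercept — is an étale, hence local, chart of `𝒰`
(`b ↦ Floc b` on `ball b₀ δ`), (2) is the injectivity of the differential of `(b, ξ) ↦ Floc b ξ`, and
the smooth structure is that of the implicit function theorem (Thm 2.11), for which the universal
family `(v, ζ) ↦ v(ζ)` is smooth. Universality: two members `u, u'` of the same intercept `b` compactify
to class-`ℓ` spheres through `q_a` with the SAME tangent there; by positivity of intersections
(Thm 2.49, p. 63: `[û]·[û']` = 1 iff exactly one intersection, transverse) their images coincide, and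
the canonical parametrisation forces `u = u'` — so the last clause holds even with `V = univ`.
-- TODO(general form): Wendl's Prop. 2.53 is for an embedded `J`-sphere `u : S² → W` with
-- `[u]·[u] = m ≥ 0` and `m` point constraints in ANY almost complex 4-manifold `W`; for the plane
-- formulation above the hypothesis `H₂(M; ℤ) = 0` would already give `[û]·[û] = 1`; the homotopy-sphere
-- hypothesis is the one the consumers (`HomotopySphere.nonempty_homotopyEquiv`) carry. The
-- end-compactification itself (gluing of charts) is not available in the tree, whence the plane form.
[cite: Wendl2018, Prop. 2.53 (m = 1), Thm 2.49, Thm 2.46, Thm 2.11] -/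
def jPlanePencil_localFamily_homotopySphere : Prop :=
  ∀ (M : Type) [TopologicalSpace M] [T2Space M] [SecondCountableTopology M] [CompactSpace M]
    [ChartedSpace (EuclideanSpace ℝ (Fin 4)) M] [IsManifold (𝓡 4) ∞ M],
    Nonempty (ContinuousMap.HomotopyEquiv M (Metric.sphere (0 : EuclideanSpace ℝ (Fin 5)) 1)) →
    ∀ (p : M) (J : ∀ x : punctured p, TangentSpace (𝓡 4) x →L[ℝ] TangentSpace (𝓡 4) x) (ε' : ℝ),
    0 < ε' →
    Metric.closedBall (extChartAt (𝓡 4) p p) ε' ⊆ (extChartAt (𝓡 4) p).target →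
    (∀ (x : punctured p) (v : TangentSpace (𝓡 4) x), J x (J x v) = -v) →
    (∀ x₀ : punctured p, ContMDiffAt (𝓡 4) 𝓘(ℝ, EuclideanSpace ℝ (Fin 4) →L[ℝ] EuclideanSpace ℝ (Fin 4)) ∞
      (inTangentCoordinates (𝓡 4) (𝓡 4) (id : punctured p → punctured p) id (fun x => J x) x₀) x₀) →
    (∀ x : punctured p, InPuncturedChartBall p ε' x →
      ∀ (v : TangentSpace (𝓡 4) x) (c : EuclideanSpace ℝ (Fin 4)),
        inner ℝ (fderiv ℝ inversion (extChartAt (𝓡 4) p x.1 - extChartAt (𝓡 4) p p)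
          (mfderiv (𝓡 4) 𝓘(ℝ, EuclideanSpace ℝ (Fin 4))
            (fun z : punctured p => extChartAt (𝓡 4) p z.1) x (J x v))) c
        = stdSymplecticForm (fderiv ℝ inversion (extChartAt (𝓡 4) p x.1 - extChartAt (𝓡 4) p p)
          (mfderiv (𝓡 4) 𝓘(ℝ, EuclideanSpace ℝ (Fin 4))
            (fun z : punctured p => extChartAt (𝓡 4) p z.1) x v)) c) →
    ∀ (u₀ : ℂ → punctured p) (b₀ : ℂ), IsPencilPlane J u₀ b₀ →
      ∃ δ : ℝ, 0 < δ ∧ ∃ Floc : ℂ → ℂ → punctured p, Floc b₀ = u₀ ∧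
        (∀ b ∈ Metric.ball b₀ δ, IsPencilPlane J (Floc b) b) ∧
        ContMDiffOn 𝓘(ℝ, ℂ × ℂ) (𝓡 4) ∞ (fun q : ℂ × ℂ => Floc q.1 q.2)
          ((Metric.ball b₀ δ) ×ˢ (univ : Set ℂ)) ∧
        (∀ q : ℂ × ℂ, q.1 ∈ Metric.ball b₀ δ →
          Function.Injective (mfderiv 𝓘(ℝ, ℂ × ℂ) (𝓡 4) (fun q : ℂ × ℂ => Floc q.1 q.2) q)) ∧
        ∃ (r₀ : ℝ) (V : Set (ℂ × punctured p)), IsOpen V ∧ (∀ ξ : ℂ, (ξ, u₀ ξ) ∈ V) ∧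
          ∀ (u : ℂ → punctured p) (b : ℂ), IsPencilPlane J u b → b ∈ Metric.ball b₀ δ →
            (∀ ξ : ℂ, ‖ξ‖ ≤ r₀ → (ξ, u ξ) ∈ V) → u = Floc b

end Literature.Geometry.Symplectic

/-! ## Proved first steps of the end-compactification of a member (step L1 of Wendl's proof)

Everything below is proved (no facts). The namespace is re-opened so that the section variables of
the statements above (`[T1Space M]`) are not in scope: the fact binds `[T2Space M]` only, and the
lemmas are stated in exactly that instance context. -/

namespace Literature.Geometry.Symplectic

/-! ### `ℝ⁴ = ℂ²` in the convention of `pencilCoord` -/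

/-- The complex flat coordinates `(y₀ + i y₁, y₂ + i y₃)` of a vector `y ∈ ℝ⁴`, the linear
identification `ℝ⁴ = ℂ²` underlying `pencilCoord` (`pencilCoord p x = flatCx (ι (e x − e p))`,
`pencilCoord_eq_flatCx`), as a continuous real-linear equivalence. [folklore] -/
def flatCx : EuclideanSpace ℝ (Fin 4) ≃L[ℝ] ℂ × ℂ :=
  LinearEquiv.toContinuousLinearEquiv
    { toFun := fun v => (⟨v 0, v 1⟩, ⟨v 2, v 3⟩)
      invFun := fun q => !₂[q.1.re, q.1.im, q.2.re, q.2.im]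
      map_add' := fun a b => by apply Prod.ext <;> apply Complex.ext <;> simp
      map_smul' := fun c a => by apply Prod.ext <;> apply Complex.ext <;> simp
      left_inv := fun v => by ext i; fin_cases i <;> rfl
      right_inv := fun q => by ext <;> rfl }

/-- `flatCx v = (v₀ + i v₁, v₂ + i v₃)`. [folklore] -/
theorem flatCx_apply (v : EuclideanSpace ℝ (Fin 4)) : flatCx v = (⟨v 0, v 1⟩, ⟨v 2, v 3⟩) := rfl

/-- `pencilCoord` is `flatCx` of the inverted recentred chart (definitional). [folklore] -/
theorem pencilCoord_eq_flatCx {M : Type*} [TopologicalSpace M]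
    [ChartedSpace (EuclideanSpace ℝ (Fin 4)) M] [T1Space M] (p : M) (x : punctured p) :
    pencilCoord p x = flatCx (inversion (extChartAt (𝓡 4) p x.1 - extChartAt (𝓡 4) p p)) := rfl

/-- Multiplication by `i` on `ℝ⁴ = ℂ²` (in the convention of `pencilCoord`):
`(y₀, y₁, y₂, y₃) ↦ (−y₁, y₀, −y₃, y₂)`, i.e. `flatCx⁻¹ ∘ (i • ·) ∘ flatCx`. [folklore] -/
def flatI : EuclideanSpace ℝ (Fin 4) →L[ℝ] EuclideanSpace ℝ (Fin 4) :=
  (flatCx.symm : ℂ × ℂ →L[ℝ] EuclideanSpace ℝ (Fin 4)).comp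
    ((mulByI (ℂ × ℂ)).comp (flatCx : EuclideanSpace ℝ (Fin 4) →L[ℝ] ℂ × ℂ))

/-- In complex coordinates `flatI` is multiplication by `i`. [folklore] -/
theorem flatCx_flatI (v : EuclideanSpace ℝ (Fin 4)) : flatCx (flatI v) = Complex.I • flatCx v := by
  simp [flatI]

/-- Coordinates of `flatI v`. [folklore] -/
theorem flatI_apply (v : EuclideanSpace ℝ (Fin 4)) : flatI v = !₂[-v 1, v 0, -v 3, v 2] := by
  have h : flatCx (flatI v) = flatCx (!₂[-v 1, v 0, -v 3, v 2]) := by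
    rw [flatCx_flatI, flatCx_apply, flatCx_apply]
    apply Prod.ext <;> apply Complex.ext <;> simp
  exact flatCx.injective h

/-- `⟪i a, c⟫ = ω₀(a, c)` on `ℝ⁴`: the complex structure `flatI` is the one `ω₀`-dual to the
Euclidean inner product, so that "`J` standard" (`⟪Dψ (J v), c⟫ = ω₀(Dψ v, c)`) reads
`Dψ ∘ J = i ∘ Dψ` in the coordinates of `pencilCoord`. [folklore] -/
theorem inner_flatI_eq_stdSymplecticForm (a c : EuclideanSpace ℝ (Fin 4)) :
    inner ℝ (flatI a) c = stdSymplecticForm a c := by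
  rw [flatI_apply, PiLp.inner_apply, Fin.sum_univ_four]
  simp only [stdSymplecticForm, RCLike.inner_apply, conj_trivial]
  simp
  ring

/-- The standardness identity determines `Dψ (J v)`: if `⟪w, c⟫ = ω₀(a, c)` for all `c` then
`w = flatI a`. [folklore] -/
theorem eq_flatI_of_inner_eq_stdSymplecticForm {w a : EuclideanSpace ℝ (Fin 4)}
    (h : ∀ c : EuclideanSpace ℝ (Fin 4), inner ℝ w c = stdSymplecticForm a c) : w = flatI a :=
  ext_inner_right ℝ fun c => by rw [h c, inner_flatI_eq_stdSymplecticForm]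

/-! ### Proper maps into `M ∖ {p}` tend to the puncture and enter every punctured chart-ball -/

section End

variable {M : Type*} [TopologicalSpace M] [T2Space M]

/-- In a compact manifold, a proper map `u : ℂ → M ∖ {p}` tends to `p` at infinity: for a
neighbourhood `U` of `p`, `M ∖ U` is a compact subset of `M ∖ {p}`, so its preimage is compact.
[folklore] -/
theorem tendsto_val_cocompact_of_proper [CompactSpace M] {p : M} {u : ℂ → punctured p}
    (hprop : ∀ K : Set (punctured p), IsCompact K → IsCompact (u ⁻¹' K)) :
    Tendsto (fun ξ => (u ξ).1) (cocompact ℂ) (𝓝 p) := by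
  intro U hU
  obtain ⟨V, hVU, hVo, hpV⟩ := mem_nhds_iff.1 hU
  -- `K = M ∖ V`, seen in `M ∖ {p}`
  set K : Set (punctured p) := {x | x.1 ∉ V} with hK
  have hKc : IsCompact K := by
    rw [Subtype.isCompact_iff]
    have himg : (((↑) : punctured p → M) '' K) = Vᶜ := by
      ext y
      constructor
      · rintro ⟨x, hx, rfl⟩
        exact hx
      · intro hy
        have hyp : y ≠ p := fun h => hy (h ▸ hpV)
        exact ⟨⟨y, mem_punctured.2 hyp⟩, hy, rfl⟩
    rw [himg]
    exact hVo.isClosed_compl.isCompact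
  have hc := hprop K hKc
  rw [Filter.mem_map, Filter.mem_cocompact]
  refine ⟨u ⁻¹' K, hc, fun ξ hξ => ?_⟩
  simp only [mem_compl_iff, mem_preimage, hK, mem_setOf_eq, not_not] at hξ
  exact hVU hξ

variable [ChartedSpace (EuclideanSpace ℝ (Fin 4)) M]

/-- In a compact manifold the complement, in `M ∖ {p}`, of a punctured chart-ball at `p` of
positive radius is compact: it is the closed set `M ∖ B` of `M`, `B` the (open, non-punctured)
chart-ball, which avoids `p`. (Universe-polymorphic form of
`gromov_recognitionR4_relEnd.isCompact_compl_setOf_inPuncturedChartBall`.) [folklore] -/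
theorem isCompact_compl_inPuncturedChartBall [CompactSpace M] (p : M) {r : ℝ} (hr : 0 < r) :
    IsCompact ({x : punctured p | InPuncturedChartBall p r x}ᶜ) := by
  set B : Set M := {y : M | y ∈ (chartAt (EuclideanSpace ℝ (Fin 4)) p).source ∧
      extChartAt (𝓡 4) p y ∈ Metric.ball (extChartAt (𝓡 4) p p) r} with hB
  have hBo : IsOpen B := by
    have h : IsOpen ((extChartAt (𝓡 4) p).source ∩
        extChartAt (𝓡 4) p ⁻¹' Metric.ball (extChartAt (𝓡 4) p p) r) :=
      (continuousOn_extChartAt (I := 𝓡 4) p).isOpen_inter_preimage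
        (isOpen_extChartAt_source (I := 𝓡 4) p) Metric.isOpen_ball
    rw [extChartAt_source] at h
    exact h
  have hpB : p ∈ B := ⟨mem_chart_source _ p, Metric.mem_ball_self hr⟩
  rw [Subtype.isCompact_iff]
  have himg : (((↑) : punctured p → M) '' ({x : punctured p | InPuncturedChartBall p r x}ᶜ)) =
      Bᶜ := by
    ext y
    constructor
    · rintro ⟨x, hx, rfl⟩
      exact hx
    · intro hy
      have hyp : y ≠ p := fun h => hy (h ▸ hpB)
      exact ⟨⟨y, mem_punctured.2 hyp⟩, hy, rfl⟩
  rw [himg]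
  exact hBo.isClosed_compl.isCompact

/-- A proper map `u : ℂ → M ∖ {p}` into a compact manifold eventually (at infinity) takes values
in the punctured chart-ball of any positive radius at `p` (its complement in `M ∖ {p}` is
compact). [folklore] -/
theorem eventually_inPuncturedChartBall_of_proper [CompactSpace M] {p : M} {u : ℂ → punctured p}
    (hprop : ∀ K : Set (punctured p), IsCompact K → IsCompact (u ⁻¹' K)) {r : ℝ} (hr : 0 < r) :
    ∀ᶠ ξ in cocompact ℂ, InPuncturedChartBall p r (u ξ) := by
  have hc := hprop _ (isCompact_compl_inPuncturedChartBall p hr)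
  rw [Filter.Eventually, Filter.mem_cocompact]
  exact ⟨_, hc, fun ξ hξ => by simpa using hξ⟩

end End

/-! ### `J`-holomorphic maps are holomorphic in the flat coordinates where `J` is standard -/

section Flat

variable {M : Type*} [TopologicalSpace M] [ChartedSpace (EuclideanSpace ℝ (Fin 4)) M] [T2Space M]

/-- The inverted recentred chart never vanishes on `M ∖ {p}` within the chart source (the
extended chart is injective on its source, which contains `p`). [folklore] -/
theorem extChartAt_sub_ne_zero {p : M} (x : punctured p)
    (hx : x.1 ∈ (chartAt (EuclideanSpace ℝ (Fin 4)) p).source) :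
    extChartAt (𝓡 4) p x.1 - extChartAt (𝓡 4) p p ≠ 0 := by
  intro h
  rw [sub_eq_zero] at h
  have hx' : x.1 ∈ (extChartAt (𝓡 4) p).source := by rwa [extChartAt_source]
  have := (extChartAt (𝓡 4) p).injOn hx' (mem_extChartAt_source p) h
  exact (mem_punctured.1 x.2) this

variable [IsManifold (𝓡 4) ∞ M]

/-- Chain rule for the ambient chart along a map into the punctured manifold: for
`u : ℂ → M ∖ {p}` smooth at `ξ` with `u ξ` in the source of the chart at `p`, the flat map
`ζ ↦ e (u ζ)` has derivative `De_{u ξ} ∘ du(ξ)` at `ξ`, where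
`De_x = mfderiv (fun z : M ∖ {p} => e z)` is the derivative occurring in the standardness
hypothesis of `jPlanePencil_localFamily_homotopySphere` (the inclusion `M ∖ {p} → M` has identity
differential, `OpenSubmanifold.mdifferentiableAt_subtype_val`). [folklore] -/
theorem hasFDerivAt_extChartAt_comp_val {p : M} {u : ℂ → punctured p} {ξ : ℂ}
    (hu : ContMDiffAt 𝓘(ℝ, ℂ) (𝓡 4) ∞ u ξ)
    (hξ : (u ξ).1 ∈ (chartAt (EuclideanSpace ℝ (Fin 4)) p).source) :
    HasFDerivAt (fun ζ => extChartAt (𝓡 4) p (u ζ).1)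
      ((mfderiv (𝓡 4) 𝓘(ℝ, EuclideanSpace ℝ (Fin 4))
          (fun z : punctured p => extChartAt (𝓡 4) p z.1) (u ξ)).comp
        (mfderiv 𝓘(ℝ, ℂ) (𝓡 4) u ξ)) ξ := by
  have hF : MDifferentiableAt (𝓡 4) 𝓘(ℝ, EuclideanSpace ℝ (Fin 4))
      (fun z : punctured p => extChartAt (𝓡 4) p z.1) (u ξ) :=
    (mdifferentiableAt_extChartAt (I := 𝓡 4) hξ).comp (u ξ)
      (Literature.Geometry.Manifold.OpenSubmanifold.mdifferentiableAt_subtype_val (u ξ))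
  have hcomp := hF.hasMFDerivAt.comp ξ (hu.mdifferentiableAt (by simp)).hasMFDerivAt
  exact hcomp.hasFDerivAt

/-- **A `J`-holomorphic map is holomorphic in the flat coordinates of the end wherever `J` is
standard** (step L1 of the end-compactification of a member; Wendl 2018, proof of Prop. 2.53 with
`Ĵ = i` near the constraint point). If `u : ℂ → M ∖ {p}` is `C^∞` at `ξ`,
`du(ξ)(iζ) = J (du(ξ) ζ)`, `u ξ` lies in the source of the chart at `p`, and `J` is standard at
`u ξ` (`⟪Dψ (J v), c⟫ = ω₀(Dψ v, c)` for `ψ = ι ∘ (e − e p)`, verbatim the hypothesis of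
`jPlanePencil_localFamily_homotopySphere`), then `ζ ↦ pencilCoord p (u ζ)` is complex
differentiable at `ξ`: its real derivative is `flatCx ∘ Dψ ∘ du(ξ)` (chain rule), and
`Dψ ∘ J = i ∘ Dψ` (`eq_flatI_of_inner_eq_stdSymplecticForm`) makes it commute with `i`, so it is
complex linear (`exists_restrictScalars_eq_of_map_mul_I`). [folklore] -/
theorem differentiableAt_pencilCoord_comp {p : M}
    {J : ∀ x : punctured p, TangentSpace (𝓡 4) x →L[ℝ] TangentSpace (𝓡 4) x}
    {u : ℂ → punctured p} {ξ : ℂ}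
    (hu : ContMDiffAt 𝓘(ℝ, ℂ) (𝓡 4) ∞ u ξ)
    (hhol : ∀ ζ : ℂ, mfderiv 𝓘(ℝ, ℂ) (𝓡 4) u ξ (Complex.I * ζ : ℂ) =
      J (u ξ) (mfderiv 𝓘(ℝ, ℂ) (𝓡 4) u ξ (ζ : ℂ)))
    (hξ : (u ξ).1 ∈ (chartAt (EuclideanSpace ℝ (Fin 4)) p).source)
    (hstd : ∀ (v : TangentSpace (𝓡 4) (u ξ)) (c : EuclideanSpace ℝ (Fin 4)),
      inner ℝ (fderiv ℝ inversion (extChartAt (𝓡 4) p (u ξ).1 - extChartAt (𝓡 4) p p)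
        (mfderiv (𝓡 4) 𝓘(ℝ, EuclideanSpace ℝ (Fin 4))
          (fun z : punctured p => extChartAt (𝓡 4) p z.1) (u ξ) (J (u ξ) v))) c
      = stdSymplecticForm (fderiv ℝ inversion (extChartAt (𝓡 4) p (u ξ).1 - extChartAt (𝓡 4) p p)
        (mfderiv (𝓡 4) 𝓘(ℝ, EuclideanSpace ℝ (Fin 4))
          (fun z : punctured p => extChartAt (𝓡 4) p z.1) (u ξ) v)) c) :
    DifferentiableAt ℂ (fun ζ => pencilCoord p (u ζ)) ξ := by
  have hy0 : extChartAt (𝓡 4) p (u ξ).1 - extChartAt (𝓡 4) p p ≠ 0 :=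
    extChartAt_sub_ne_zero (u ξ) hξ
  -- standardness: `Dι ∘ De ∘ J = flatI ∘ Dι ∘ De`
  have hJ : ∀ v : TangentSpace (𝓡 4) (u ξ),
      fderiv ℝ inversion (extChartAt (𝓡 4) p (u ξ).1 - extChartAt (𝓡 4) p p)
        (mfderiv (𝓡 4) 𝓘(ℝ, EuclideanSpace ℝ (Fin 4))
          (fun z : punctured p => extChartAt (𝓡 4) p z.1) (u ξ) (J (u ξ) v)) =
      flatI (fderiv ℝ inversion (extChartAt (𝓡 4) p (u ξ).1 - extChartAt (𝓡 4) p p)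
        (mfderiv (𝓡 4) 𝓘(ℝ, EuclideanSpace ℝ (Fin 4))
          (fun z : punctured p => extChartAt (𝓡 4) p z.1) (u ξ) v)) :=
    fun v => eq_flatI_of_inner_eq_stdSymplecticForm (hstd v)
  -- the real derivative of `pencilCoord ∘ u` at `ξ` (chain rule)
  have h1 := (hasFDerivAt_extChartAt_comp_val hu hξ).sub_const (extChartAt (𝓡 4) p p)
  have h2 : HasFDerivAt inversion
      (fderiv ℝ inversion (extChartAt (𝓡 4) p (u ξ).1 - extChartAt (𝓡 4) p p))
      (extChartAt (𝓡 4) p (u ξ).1 - extChartAt (𝓡 4) p p) :=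
    (differentiableAt_inversion hy0).hasFDerivAt
  have h12 := h2.comp ξ h1
  have hder := flatCx.hasFDerivAt.comp ξ h12
  have hfun : (fun ζ => pencilCoord p (u ζ)) =
      (⇑flatCx ∘ (inversion ∘
        fun ζ => extChartAt (𝓡 4) p (u ζ).1 - extChartAt (𝓡 4) p p)) := rfl
  rw [hfun]
  -- it commutes with `i`
  have hLI : ∀ ζ : ℂ,
      ((flatCx : EuclideanSpace ℝ (Fin 4) →L[ℝ] ℂ × ℂ).comp
        ((fderiv ℝ inversion (extChartAt (𝓡 4) p (u ξ).1 - extChartAt (𝓡 4) p p)).comp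
          ((mfderiv (𝓡 4) 𝓘(ℝ, EuclideanSpace ℝ (Fin 4))
              (fun z : punctured p => extChartAt (𝓡 4) p z.1) (u ξ)).comp
            (mfderiv 𝓘(ℝ, ℂ) (𝓡 4) u ξ)))) (Complex.I * ζ) =
      Complex.I • ((flatCx : EuclideanSpace ℝ (Fin 4) →L[ℝ] ℂ × ℂ).comp
        ((fderiv ℝ inversion (extChartAt (𝓡 4) p (u ξ).1 - extChartAt (𝓡 4) p p)).comp
          ((mfderiv (𝓡 4) 𝓘(ℝ, EuclideanSpace ℝ (Fin 4))
              (fun z : punctured p => extChartAt (𝓡 4) p z.1) (u ξ)).comp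
            (mfderiv 𝓘(ℝ, ℂ) (𝓡 4) u ξ)))) ζ := fun ζ => by
    show flatCx (fderiv ℝ inversion (extChartAt (𝓡 4) p (u ξ).1 - extChartAt (𝓡 4) p p)
        (mfderiv (𝓡 4) 𝓘(ℝ, EuclideanSpace ℝ (Fin 4))
          (fun z : punctured p => extChartAt (𝓡 4) p z.1) (u ξ)
          (mfderiv 𝓘(ℝ, ℂ) (𝓡 4) u ξ (Complex.I * ζ)))) =
      Complex.I • flatCx (fderiv ℝ inversion (extChartAt (𝓡 4) p (u ξ).1 - extChartAt (𝓡 4) p p)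
        (mfderiv (𝓡 4) 𝓘(ℝ, EuclideanSpace ℝ (Fin 4))
          (fun z : punctured p => extChartAt (𝓡 4) p z.1) (u ξ)
          (mfderiv 𝓘(ℝ, ℂ) (𝓡 4) u ξ ζ)))
    rw [hhol ζ, hJ, flatCx_flatI]
  obtain ⟨g, hg⟩ := exists_restrictScalars_eq_of_map_mul_I _ hLI
  exact (differentiableAt_iff_restrictScalars ℝ hder.differentiableAt).2
    ⟨g, hg.trans hder.fderiv.symm⟩

/-! ### Consequences for pencil members -/

variable {p : M} {J : ∀ x : punctured p, TangentSpace (𝓡 4) x →L[ℝ] TangentSpace (𝓡 4) x}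
  {u : ℂ → punctured p} {b : ℂ}

omit [IsManifold (𝓡 4) ∞ M] in
/-- A pencil member is proper. [folklore] -/
theorem IsPencilPlane.isCompact_preimage (hu : IsPencilPlane J u b) {K : Set (punctured p)}
    (hK : IsCompact K) : IsCompact (u ⁻¹' K) :=
  hu.2.2.2.1 K hK

omit [IsManifold (𝓡 4) ∞ M] in
/-- **A pencil member tends to the puncture at infinity** (`M` compact: properness).
[folklore] -/
theorem IsPencilPlane.tendsto_nhds [CompactSpace M] (hu : IsPencilPlane J u b) :
    Tendsto (fun ξ => (u ξ).1) (cocompact ℂ) (𝓝 p) :=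
  tendsto_val_cocompact_of_proper hu.2.2.2.1

omit [IsManifold (𝓡 4) ∞ M] in
/-- A pencil member eventually (at infinity) lies in every punctured chart-ball at `p`.
[folklore] -/
theorem IsPencilPlane.eventually_inPuncturedChartBall [CompactSpace M] (hu : IsPencilPlane J u b)
    {r : ℝ} (hr : 0 < r) : ∀ᶠ ξ in cocompact ℂ, InPuncturedChartBall p r (u ξ) :=
  eventually_inPuncturedChartBall_of_proper hu.2.2.2.1 hr

/-- **Step L1 for members: a pencil member is eventually holomorphic in the flat coordinates.**
If `J` is standard on the punctured `ε'`-chart-ball at `p` (the hypothesis of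
`jPlanePencil_localFamily_homotopySphere`, verbatim) and `M` is compact, then for a member `u`
the flat-coordinate map `ξ ↦ pencilCoord p (u ξ) = (z(u ξ), w(u ξ))` is complex differentiable at
every `ξ` outside a compact set. [folklore] -/
theorem IsPencilPlane.eventually_differentiableAt_pencilCoord [CompactSpace M]
    (hu : IsPencilPlane J u b) {ε' : ℝ} (hε' : 0 < ε')
    (hstd : ∀ x : punctured p, InPuncturedChartBall p ε' x →
      ∀ (v : TangentSpace (𝓡 4) x) (c : EuclideanSpace ℝ (Fin 4)),
        inner ℝ (fderiv ℝ inversion (extChartAt (𝓡 4) p x.1 - extChartAt (𝓡 4) p p)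
          (mfderiv (𝓡 4) 𝓘(ℝ, EuclideanSpace ℝ (Fin 4))
            (fun z : punctured p => extChartAt (𝓡 4) p z.1) x (J x v))) c
        = stdSymplecticForm (fderiv ℝ inversion (extChartAt (𝓡 4) p x.1 - extChartAt (𝓡 4) p p)
          (mfderiv (𝓡 4) 𝓘(ℝ, EuclideanSpace ℝ (Fin 4))
            (fun z : punctured p => extChartAt (𝓡 4) p z.1) x v)) c) :
    ∀ᶠ ξ in cocompact ℂ, DifferentiableAt ℂ (fun ζ => pencilCoord p (u ζ)) ξ := by
  filter_upwards [hu.eventually_inPuncturedChartBall hε'] with ξ hξ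
  exact differentiableAt_pencilCoord_comp (hu.1.1 ξ) (hu.1.2.2 ξ) hξ.1 (hstd (u ξ) hξ)

/-- **Step L1, radius form**: under the same hypotheses there is `R` such that
`ξ ↦ pencilCoord p (u ξ)` is complex differentiable on `{ξ | R ≤ ‖ξ‖}` (indeed at every point of it).
[folklore] -/
theorem IsPencilPlane.exists_differentiableOn_pencilCoord [CompactSpace M]
    (hu : IsPencilPlane J u b) {ε' : ℝ} (hε' : 0 < ε')
    (hstd : ∀ x : punctured p, InPuncturedChartBall p ε' x →
      ∀ (v : TangentSpace (𝓡 4) x) (c : EuclideanSpace ℝ (Fin 4)),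
        inner ℝ (fderiv ℝ inversion (extChartAt (𝓡 4) p x.1 - extChartAt (𝓡 4) p p)
          (mfderiv (𝓡 4) 𝓘(ℝ, EuclideanSpace ℝ (Fin 4))
            (fun z : punctured p => extChartAt (𝓡 4) p z.1) x (J x v))) c
        = stdSymplecticForm (fderiv ℝ inversion (extChartAt (𝓡 4) p x.1 - extChartAt (𝓡 4) p p)
          (mfderiv (𝓡 4) 𝓘(ℝ, EuclideanSpace ℝ (Fin 4))
            (fun z : punctured p => extChartAt (𝓡 4) p z.1) x v)) c) :
    ∃ R : ℝ, (∀ ξ : ℂ, R ≤ ‖ξ‖ → DifferentiableAt ℂ (fun ζ => pencilCoord p (u ζ)) ξ) ∧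
      DifferentiableOn ℂ (fun ζ => pencilCoord p (u ζ)) {ξ | R ≤ ‖ξ‖} := by
  have h := hu.eventually_differentiableAt_pencilCoord hε' hstd
  rw [← Metric.cobounded_eq_cocompact, (hasBasis_cobounded_norm (E := ℂ)).eventually_iff] at h
  obtain ⟨R, -, hR⟩ := h
  exact ⟨R, fun ξ hξ => hR hξ, fun ξ hξ => (hR hξ).differentiableWithinAt⟩

end Flat

/-! ## Step B of Wendl's proof: rigidity of the canonical parametrisation (proved)

Two pencil members with the same image are equal (`IsPencilPlane.eq_of_range_eq`); in particular a
member is determined by its image, and the intercept by the image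
(`IsPencilPlane.intercept_eq_of_range_eq`). This is the step that removes the `Aut(ℂ)`-ambiguity in
the universality clause of `jPlanePencil_localFamily_homotopySphere` (and in Wendl's identification
of nearby curves with sections of the normal bundle, proof of Prop. 2.53): given it, "two members of
the same intercept have the same IMAGE" (Thm 2.49 in the end-compactification) already yields
`u = Floc b`. -/

open Function

/-! ### Chart calculus on a manifold charted on `ℝ⁴` (here: the open submanifold `M ∖ {p}`) -/

section ChartCalculus

variable {N : Type*} [TopologicalSpace N] [ChartedSpace (EuclideanSpace ℝ (Fin 4)) N]
  [IsManifold (𝓡 4) ∞ N]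

/-- Smoothness of a chart expression: `u` smooth at `η` with `u η` in the chart source at `x₀`
gives `e_{x₀} ∘ u` smooth at `η`. [folklore] -/
theorem contDiffAt_extChartAt_comp {x₀ : N} {u : ℂ → N} {η : ℂ}
    (hu : ContMDiffAt 𝓘(ℝ, ℂ) (𝓡 4) ∞ u η)
    (hη : u η ∈ (chartAt (EuclideanSpace ℝ (Fin 4)) x₀).source) :
    ContDiffAt ℝ ∞ (fun ζ => extChartAt (𝓡 4) x₀ (u ζ)) η :=
  contMDiffAt_iff_contDiffAt.1 ((contMDiffAt_iff_target_of_mem_source hη).1 hu).2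

/-- Chain rule for a chart expression: `D(e_{x₀} ∘ u)(η) = De_{x₀}(u η) ∘ du(η)`. [folklore] -/
theorem hasFDerivAt_extChartAt_comp {x₀ : N} {u : ℂ → N} {η : ℂ}
    (hu : ContMDiffAt 𝓘(ℝ, ℂ) (𝓡 4) ∞ u η)
    (hη : u η ∈ (chartAt (EuclideanSpace ℝ (Fin 4)) x₀).source) :
    HasFDerivAt (fun ζ => extChartAt (𝓡 4) x₀ (u ζ))
      ((mfderiv (𝓡 4) 𝓘(ℝ, EuclideanSpace ℝ (Fin 4)) (extChartAt (𝓡 4) x₀) (u η)).comp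
        (mfderiv 𝓘(ℝ, ℂ) (𝓡 4) u η)) η :=
  ((mdifferentiableAt_extChartAt (I := 𝓡 4) hη).hasMFDerivAt.comp η
    (hu.mdifferentiableAt (by simp)).hasMFDerivAt).hasFDerivAt

/-- The differential of an extended chart is injective on the chart source. [folklore] -/
theorem injective_mfderiv_extChartAt {x₀ x : N}
    (hx : x ∈ (chartAt (EuclideanSpace ℝ (Fin 4)) x₀).source) :
    Injective (mfderiv (𝓡 4) 𝓘(ℝ, EuclideanSpace ℝ (Fin 4)) (extChartAt (𝓡 4) x₀) x) := by
  have hx' : x ∈ (extChartAt (𝓡 4) x₀).source := by rwa [extChartAt_source]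
  have key : ∀ v : TangentSpace (𝓡 4) x,
      mfderivWithin 𝓘(ℝ, EuclideanSpace ℝ (Fin 4)) (𝓡 4) (extChartAt (𝓡 4) x₀).symm
          (range (𝓡 4)) (extChartAt (𝓡 4) x₀ x)
        (mfderiv (𝓡 4) 𝓘(ℝ, EuclideanSpace ℝ (Fin 4)) (extChartAt (𝓡 4) x₀) x v) = v := fun v =>
    DFunLike.congr_fun (mfderivWithin_extChartAt_symm_comp_mfderiv_extChartAt' (I := 𝓡 4) hx') v
  intro v w hvw
  rw [← key v, ← key w, hvw]

end ChartCalculus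

/-! ### Rigidity of the canonical parametrisation of a pencil member -/

section Rigidity

variable {M : Type*} [TopologicalSpace M] [ChartedSpace (EuclideanSpace ℝ (Fin 4)) M] [T2Space M]
  {p : M} {J : ∀ x : punctured p, TangentSpace (𝓡 4) x →L[ℝ] TangentSpace (𝓡 4) x}
  {u u' : ℂ → punctured p} {b b' : ℂ}

/-- A pencil member is a closed embedding `ℂ → M ∖ {p}` (continuous, injective and proper
into a locally compact Hausdorff space). [folklore] -/
theorem IsPencilPlane.isClosedEmbedding (hu : IsPencilPlane J u b) : Topology.IsClosedEmbedding u := by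
  haveI : LocallyCompactSpace (punctured p) :=
    ChartedSpace.locallyCompactSpace (EuclideanSpace ℝ (Fin 4)) _
  have hc : Continuous u := hu.1.1.continuous
  have hprop : IsProperMap u :=
    isProperMap_iff_isCompact_preimage.2 ⟨hc, fun K hK => hu.2.2.2.1 K hK⟩
  exact .of_continuous_injective_isClosedMap hc hu.2.1 hprop.isClosedMap

/-- **Transition map between two members with the same image.** If `u, u'` are pencil members
with `range u = range u'`, there is a homeomorphism `h` of `ℂ` with `u = u' ∘ h`
(namely `h = u'⁻¹ ∘ u`, continuous because members are closed embeddings). [folklore] -/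
theorem IsPencilPlane.exists_homeomorph_comp_eq (hu : IsPencilPlane J u b)
    (hu' : IsPencilPlane J u' b') (hr : range u = range u') :
    ∃ h : ℂ ≃ₜ ℂ, ∀ ξ, u' (h ξ) = u ξ := by
  obtain ⟨e, he⟩ : ∃ e : ℂ ≃ₜ range u, ∀ x, (e x).1 = u x :=
    ⟨hu.isClosedEmbedding.isEmbedding.toHomeomorph, fun x => by simp⟩
  obtain ⟨e', he'⟩ : ∃ e' : ℂ ≃ₜ range u', ∀ x, (e' x).1 = u' x :=
    ⟨hu'.isClosedEmbedding.isEmbedding.toHomeomorph, fun x => by simp⟩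
  have hval' : ∀ y : range u', u' (e'.symm y) = y.1 := fun y => by
    rw [← he', e'.apply_symm_apply]
  -- `h = e'⁻¹ ∘ (range u = range u') ∘ e`
  refine ⟨e.trans ((Homeomorph.setCongr hr).trans e'.symm), fun ξ => ?_⟩
  simp only [Homeomorph.trans_apply]
  rw [hval']
  exact he ξ

variable [IsManifold (𝓡 4) ∞ M]

/-- **Smoothness of the transition map.** If `u = u' ∘ h` with `h` continuous at `ξ₀`, `u`
smooth at `ξ₀` and `u'` a smooth immersion at `h ξ₀`, then `h` is `C^∞` at `ξ₀`: a left inverse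
`P` of the injective differential of the chart expression `f = e ∘ u'` at `h ξ₀` makes `P ∘ f` a
local diffeomorphism of `ℂ` at `h ξ₀` (inverse function theorem), and
`h = (P ∘ f)⁻¹ ∘ P ∘ e ∘ u` near `ξ₀`. [folklore] -/
theorem contDiffAt_of_comp_eq_of_injective_mfderiv {h : ℂ → ℂ} {ξ₀ : ℂ}
    (hh : ContinuousAt h ξ₀) (hcomp : ∀ ξ, u' (h ξ) = u ξ)
    (hu : ContMDiffAt 𝓘(ℝ, ℂ) (𝓡 4) ∞ u ξ₀)
    (hu' : ContMDiff 𝓘(ℝ, ℂ) (𝓡 4) ∞ u')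
    (himm : Injective (mfderiv 𝓘(ℝ, ℂ) (𝓡 4) u' (h ξ₀))) :
    ContDiffAt ℝ ∞ h ξ₀ := by
  set η₀ := h ξ₀ with hη₀
  set x₀ : punctured p := u' η₀ with hx₀
  -- chart expression of `u'` at `η₀` and its injective differential
  set f : ℂ → EuclideanSpace ℝ (Fin 4) := fun η => extChartAt (𝓡 4) x₀ (u' η) with hf
  have hsrc : u' η₀ ∈ (chartAt (EuclideanSpace ℝ (Fin 4)) x₀).source := mem_chart_source _ x₀
  have hfc : ContDiffAt ℝ ∞ f η₀ := contDiffAt_extChartAt_comp (hu' η₀) hsrc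
  set L : ℂ →L[ℝ] EuclideanSpace ℝ (Fin 4) :=
    (mfderiv (𝓡 4) 𝓘(ℝ, EuclideanSpace ℝ (Fin 4)) (extChartAt (𝓡 4) x₀) (u' η₀)).comp
      (mfderiv 𝓘(ℝ, ℂ) (𝓡 4) u' η₀) with hL
  have hfd : HasFDerivAt f L η₀ := hasFDerivAt_extChartAt_comp (hu' η₀) hsrc
  have hLinj : Injective L := (injective_mfderiv_extChartAt hsrc).comp himm
  -- a continuous linear left inverse `P` of `L`
  obtain ⟨Pl, hPl⟩ := (L : ℂ →ₗ[ℝ] EuclideanSpace ℝ (Fin 4)).exists_leftInverse_of_injective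
    (LinearMap.ker_eq_bot.2 hLinj)
  set P : EuclideanSpace ℝ (Fin 4) →L[ℝ] ℂ := LinearMap.toContinuousLinearMap Pl with hP
  have hPL : ∀ v, P (L v) = v := fun v => by
    have := LinearMap.congr_fun hPl v
    simpa [hP] using this
  -- `g = P ∘ f` is a local diffeomorphism of `ℂ` at `η₀`
  set g : ℂ → ℂ := fun η => P (f η) with hg
  have hgc : ContDiffAt ℝ ∞ g η₀ := P.contDiff.contDiffAt.comp η₀ hfc
  have hgd : HasFDerivAt g ((ContinuousLinearEquiv.refl ℝ ℂ : ℂ ≃L[ℝ] ℂ) : ℂ →L[ℝ] ℂ) η₀ := by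
    have h1 : HasFDerivAt g (P.comp L) η₀ := P.hasFDerivAt.comp η₀ hfd
    refine h1.congr_fderiv ?_
    ext1 v
    simp [hPL]
  have hn : (∞ : WithTop ℕ∞) ≠ 0 := by simp
  have hleft : ∀ᶠ η in 𝓝 η₀, hgc.localInverse hgd hn (g η) = η :=
    (hgc.hasStrictFDerivAt' hgd hn).eventually_left_inverse
  have hinvc : ContDiffAt ℝ ∞ (hgc.localInverse hgd hn) (g η₀) := hgc.to_localInverse hgd hn
  -- near `ξ₀`, `h = g⁻¹ ∘ P ∘ e ∘ u`
  have hev : h =ᶠ[𝓝 ξ₀] fun ξ => hgc.localInverse hgd hn (P (extChartAt (𝓡 4) x₀ (u ξ))) := by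
    filter_upwards [hh.eventually hleft] with ξ hξ
    rw [← hξ]
    simp only [hg, hf, hcomp]
  refine ContDiffAt.congr_of_eventuallyEq ?_ hev
  have hux : u ξ₀ ∈ (chartAt (EuclideanSpace ℝ (Fin 4)) x₀).source := by
    rw [← hcomp ξ₀]; exact hsrc
  have h3 : ContDiffAt ℝ ∞ (fun ξ => P (extChartAt (𝓡 4) x₀ (u ξ))) ξ₀ :=
    P.contDiff.contDiffAt.comp ξ₀ (contDiffAt_extChartAt_comp hu hux)
  have hpt : g η₀ = P (extChartAt (𝓡 4) x₀ (u ξ₀)) := by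
    simp only [hg, hf]
    rw [hη₀, hcomp]
  rw [hpt] at hinvc
  exact hinvc.comp ξ₀ h3

omit [IsManifold (𝓡 4) ∞ M] in
/-- **Holomorphy of the transition map.** If `u = u' ∘ h` with `u, u'` `J`-holomorphic,
`h` real differentiable at `ξ₀`, and `du'(h ξ₀)` injective, then `dh(ξ₀)` commutes with `i`
(`du' ∘ dh = du` intertwines `i` with `J` on both sides). [folklore] -/
theorem fderiv_transition_mul_I {h : ℂ → ℂ} {ξ₀ : ℂ}
    (hcomp : ∀ ξ, u' (h ξ) = u ξ) (hhd : DifferentiableAt ℝ h ξ₀)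
    (hu'd : MDifferentiableAt 𝓘(ℝ, ℂ) (𝓡 4) u' (h ξ₀))
    (hhol : ∀ ζ : ℂ, mfderiv 𝓘(ℝ, ℂ) (𝓡 4) u ξ₀ (Complex.I * ζ : ℂ) =
      J (u ξ₀) (mfderiv 𝓘(ℝ, ℂ) (𝓡 4) u ξ₀ (ζ : ℂ)))
    (hhol' : ∀ ζ : ℂ, mfderiv 𝓘(ℝ, ℂ) (𝓡 4) u' (h ξ₀) (Complex.I * ζ : ℂ) =
      J (u' (h ξ₀)) (mfderiv 𝓘(ℝ, ℂ) (𝓡 4) u' (h ξ₀) (ζ : ℂ)))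
    (himm : Injective (mfderiv 𝓘(ℝ, ℂ) (𝓡 4) u' (h ξ₀))) (ζ : ℂ) :
    fderiv ℝ h ξ₀ (Complex.I * ζ) = Complex.I * fderiv ℝ h ξ₀ ζ := by
  have hfun : u = u' ∘ h := funext fun ξ => (hcomp ξ).symm
  have hchain : mfderiv 𝓘(ℝ, ℂ) (𝓡 4) u ξ₀ =
      (mfderiv 𝓘(ℝ, ℂ) (𝓡 4) u' (h ξ₀)).comp (mfderiv 𝓘(ℝ, ℂ) 𝓘(ℝ, ℂ) h ξ₀) := by
    rw [hfun]
    exact mfderiv_comp ξ₀ hu'd hhd.mdifferentiableAt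
  -- pointwise chain rule with the flat derivative of `h`
  have e1 : ∀ v : ℂ, mfderiv 𝓘(ℝ, ℂ) (𝓡 4) u ξ₀ v =
      mfderiv 𝓘(ℝ, ℂ) (𝓡 4) u' (h ξ₀) (mfderiv 𝓘(ℝ, ℂ) 𝓘(ℝ, ℂ) h ξ₀ v) := fun v => by
    rw [hchain]
    rfl
  have e2 : ∀ v : ℂ, mfderiv 𝓘(ℝ, ℂ) 𝓘(ℝ, ℂ) h ξ₀ v = fderiv ℝ h ξ₀ v := fun v =>
    DFunLike.congr_fun (mfderiv_eq_fderiv (f := h) (x := ξ₀)) v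
  -- `J (u ξ₀) = J (u' (h ξ₀))` along `u ξ₀ = u' (h ξ₀)`
  have hJ : ∀ v : EuclideanSpace ℝ (Fin 4), J (u ξ₀) v = J (u' (h ξ₀)) v := by
    intro v
    have := hcomp ξ₀
    exact congrArg (fun x : punctured p => (J x : EuclideanSpace ℝ (Fin 4) →L[ℝ]
      EuclideanSpace ℝ (Fin 4)) v) this.symm
  apply himm
  have key := hhol ζ
  rw [e1, e1, e2, e2, hJ] at key
  exact key.trans (hhol' (fderiv ℝ h ξ₀ ζ)).symm

/-- **Rigidity of the canonical parametrisation** (the step of Wendl's proof of Prop. 2.53 /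
of the universality clause that removes the `Aut(ℂ)`-ambiguity): two pencil members with the same
image are equal. The transition map `h = u'⁻¹ ∘ u` is a homeomorphism of `ℂ` (members are closed
embeddings), `C^∞` (inverse function theorem applied to a chart expression of the immersion `u'`),
holomorphic (`du' ∘ dh = du` intertwines `i` and `J`), hence an entire automorphism of `ℂ`;
the asymptotics `z(u ξ) − ξ → 0`, `z(u' ξ) − ξ → 0` and properness of `h` give `h ξ − ξ → 0` at
infinity, so `h = id` by Liouville. [folklore] -/
theorem IsPencilPlane.eq_of_range_eq (hu : IsPencilPlane J u b) (hu' : IsPencilPlane J u' b')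
    (hr : range u = range u') : u = u' := by
  obtain ⟨h, hcomp⟩ := hu.exists_homeomorph_comp_eq hu' hr
  -- `h` is smooth and holomorphic
  have hsmooth : ∀ ξ, ContDiffAt ℝ ∞ h ξ := fun ξ =>
    contDiffAt_of_comp_eq_of_injective_mfderiv h.continuous.continuousAt hcomp (hu.1.1 ξ)
      hu'.1.1 (hu'.2.2.1 (h ξ))
  have hdiffR : Differentiable ℝ h := fun ξ => (hsmooth ξ).differentiableAt (by simp)
  have hholh : Differentiable ℂ h := by
    refine (isJHolomorphicFlat_mulByI_iff_differentiable hdiffR).1 fun ξ ζ => ?_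
    rw [mulByI_apply, smul_eq_mul]
    exact fderiv_transition_mul_I hcomp (hdiffR ξ) ((hu'.1.1 (h ξ)).mdifferentiableAt (by simp))
      (hu.1.2.2 ξ) (hu'.1.2.2 (h ξ)) (hu'.2.2.1 (h ξ)) ζ
  -- `h ξ - ξ → 0` at infinity
  have hprop : Tendsto h (cocompact ℂ) (cocompact ℂ) := h.isClosedEmbedding.tendsto_cocompact
  have h1 : Tendsto (fun ξ : ℂ => (pencilCoord p (u ξ)).1 - ξ) (cocompact ℂ) (𝓝 0) := hu.2.2.2.2.1
  have h2 : Tendsto (fun ξ : ℂ => (pencilCoord p (u' (h ξ))).1 - h ξ) (cocompact ℂ) (𝓝 0) :=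
    hu'.2.2.2.2.1.comp hprop
  have h3 : Tendsto (fun ξ : ℂ => h ξ - ξ) (cocompact ℂ) (𝓝 0) := by
    have := h1.sub h2
    simp only [hcomp, sub_zero] at this
    refine this.congr fun ξ => ?_
    ring
  -- Liouville: `F = h - id` is entire and tends to `0` at infinity, hence is bounded, hence
  -- constant, hence `0`
  have hid : ∀ ξ, h ξ = ξ := by
    set F : ℂ → ℂ := fun ξ => h ξ - ξ with hF
    have hFd : Differentiable ℂ F := hholh.sub differentiable_id
    have hb : Bornology.IsBounded (range F) := by
      have hin : ∀ᶠ ξ in cocompact ℂ, F ξ ∈ Metric.ball (0 : ℂ) 1 :=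
        h3 (Metric.ball_mem_nhds 0 one_pos)
      rw [Filter.Eventually, Filter.mem_cocompact] at hin
      obtain ⟨K, hK, hKsub⟩ := hin
      refine ((hK.image hFd.continuous).isBounded.union
        (Metric.isBounded_ball (x := (0 : ℂ)) (r := 1))).subset ?_
      rintro _ ⟨ξ, rfl⟩
      by_cases hξ : ξ ∈ K
      · exact Or.inl ⟨ξ, hξ, rfl⟩
      · exact Or.inr (hKsub hξ)
    have hconst : ∀ ζ ξ, F ζ = F ξ := fun ζ ξ => hFd.apply_eq_apply_of_bounded hb ζ ξ
    intro ξ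
    have hlim : Tendsto F (cocompact ℂ) (𝓝 (F ξ)) := by
      rw [show F = fun _ => F ξ from funext fun ζ => hconst ζ ξ]
      exact tendsto_const_nhds
    have h0 : F ξ = 0 := tendsto_nhds_unique hlim h3
    simpa [hF, sub_eq_zero] using h0
  funext ξ
  rw [← hcomp ξ, hid]

/-- Two pencil members with the same image have the same intercept. [folklore] -/
theorem IsPencilPlane.intercept_eq_of_range_eq (hu : IsPencilPlane J u b)
    (hu' : IsPencilPlane J u' b') (hr : range u = range u') : b = b' := by
  have heq := hu.eq_of_range_eq hu' hr
  subst heq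
  exact tendsto_nhds_unique hu.2.2.2.2.2 hu'.2.2.2.2.2

end Rigidity

/-! ## Step L2 of Wendl's proof: removable singularity and decay of a member at infinity (proved)

In the coordinate `η = 1/ξ` at `∞ ∈ S² = ℂ ∪ {∞}`, the flat coordinates of a member extend
holomorphically: `z(u(η⁻¹)) − η⁻¹ → 0` and `w(u(η⁻¹)) → b` have removable singularities at
`η = 0` (`IsPencilPlane.analyticAt_fst_pencilCoord_inv`, `…analyticAt_snd_pencilCoord_inv`), whence
the expansion `z = ξ + O(1/ξ)`, `w = b + O(1/ξ)` (`IsPencilPlane.exists_decay`) — the compactified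
member `û` passes through the point `q_a` of the line at infinity with tangent direction `(1, b)`
in the chart `(1/z, w/z)`. -/

open Bornology


/-! ### Holomorphic functions near infinity with a limit: removable singularity at `∞` and decay -/

section Infinity

variable {E : Type*} [NormedAddCommGroup E] [NormedSpace ℂ E] [CompleteSpace E]

/-- **Removable singularity at infinity.** If `f : ℂ → E` is complex differentiable at every point
outside a compact set and tends to `c` at infinity, then `η ↦ f η⁻¹`, extended by `c` at `η = 0`,
is analytic at `0` (Riemann's removable singularity theorem in the coordinate `η = 1/ξ` at `∞`).
[folklore] -/
theorem analyticAt_update_comp_inv {f : ℂ → E} {c : E}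
    (hd : ∀ᶠ ξ in cocompact ℂ, DifferentiableAt ℂ f ξ) (hlim : Tendsto f (cocompact ℂ) (𝓝 c)) :
    AnalyticAt ℂ (update (fun η : ℂ => f η⁻¹) 0 c) 0 := by
  -- in `ℂ`, inversion maps punctured neighbourhoods of `0` to neighbourhoods of infinity
  -- (the named form of this is `tendsto_inv_nhdsNE_zero_cocompact` in the companion file
  -- `JPlanePencilLocalFamilyProofs.lean`)
  have hinv : Tendsto (fun η : ℂ => η⁻¹) (𝓝[≠] 0) (cocompact ℂ) := by
    rw [← Metric.cobounded_eq_cocompact]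
    exact tendsto_inv₀_nhdsNE_zero
  apply Complex.analyticAt_of_differentiable_on_punctured_nhds_of_continuousAt
  · -- differentiable on a punctured neighbourhood of `0`
    have h1 : ∀ᶠ η : ℂ in 𝓝[≠] 0, DifferentiableAt ℂ f η⁻¹ := hinv hd
    filter_upwards [h1, self_mem_nhdsWithin] with η hη hη0
    have hη0 : η ≠ 0 := hη0
    have hev : update (fun η : ℂ => f η⁻¹) 0 c =ᶠ[𝓝 η] fun η => f η⁻¹ := by
      filter_upwards [isOpen_ne.mem_nhds hη0] with η' hη'
      exact update_of_ne hη' _ _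
    refine DifferentiableAt.congr_of_eventuallyEq ?_ hev
    exact hη.comp η (differentiableAt_id.inv hη0)
  · -- continuous at `0`
    rw [continuousAt_update_same]
    exact hlim.comp hinv

/-- **Decay at infinity.** Under the same hypotheses, `‖f ξ − c‖ ≤ C / ‖ξ‖` for `‖ξ‖ ≥ R`: the
extension `g` of `η ↦ f η⁻¹` is differentiable at `0` with `g 0 = c`, so `g η − c = O(η)`.
[folklore] -/
theorem exists_norm_sub_le_div_norm {f : ℂ → E} {c : E}
    (hd : ∀ᶠ ξ in cocompact ℂ, DifferentiableAt ℂ f ξ) (hlim : Tendsto f (cocompact ℂ) (𝓝 c)) :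
    ∃ R C : ℝ, 0 < R ∧ 0 ≤ C ∧ ∀ ξ : ℂ, R ≤ ‖ξ‖ → ‖f ξ - c‖ ≤ C / ‖ξ‖ := by
  have hA := analyticAt_update_comp_inv hd hlim
  have hO := hA.differentiableAt.isBigO_sub
  simp only [update_self, sub_zero] at hO
  obtain ⟨C, hC0, hC⟩ := hO.exists_nonneg
  rw [Asymptotics.IsBigOWith_def, Metric.eventually_nhds_iff] at hC
  obtain ⟨r, hr, hrC⟩ := hC
  refine ⟨r⁻¹ + 1, C, by positivity, hC0, fun ξ hξ => ?_⟩
  have hξpos : 0 < ‖ξ‖ := lt_of_lt_of_le (by positivity) hξ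
  have hξ0 : ξ ≠ 0 := norm_pos_iff.1 hξpos
  have hinv : ‖ξ⁻¹‖ < r := by
    rw [norm_inv]
    have h1 : r⁻¹ < ‖ξ‖ := lt_of_lt_of_le (lt_add_one _) hξ
    rwa [inv_lt_comm₀ hξpos hr]
  have key := hrC (y := ξ⁻¹) (by simpa using hinv)
  rw [update_of_ne (inv_ne_zero hξ0), inv_inv, norm_inv] at key
  simpa [div_eq_mul_inv] using key

end Infinity

/-! ### Step L2 for members: expansion at infinity `z(u ξ) = ξ + O(1/ξ)`, `w(u ξ) = b + O(1/ξ)` -/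

section Members

variable {M : Type*} [TopologicalSpace M] [ChartedSpace (EuclideanSpace ℝ (Fin 4)) M] [T2Space M]
  [IsManifold (𝓡 4) ∞ M] [CompactSpace M]
  {p : M} {J : ∀ x : punctured p, TangentSpace (𝓡 4) x →L[ℝ] TangentSpace (𝓡 4) x}
  {u : ℂ → punctured p} {b : ℂ} {ε' : ℝ}

/-- **Removable singularity of a member at infinity, `z`-coordinate**: for a member `u` (with
`J` standard on the punctured `ε'`-chart-ball, the hypothesis of
`jPlanePencil_localFamily_homotopySphere`), `η ↦ z(u(η⁻¹)) − η⁻¹`, extended by `0`, is analytic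
at `η = 0`. In the end-compactification this is the holomorphy of `û` at the constraint point
`q_a` in the chart `(1/z, w/z)` (step L2 of Wendl's proof of Prop. 2.53). [folklore] -/
theorem IsPencilPlane.analyticAt_fst_pencilCoord_inv (hu : IsPencilPlane J u b) (hε' : 0 < ε')
    (hstd : ∀ x : punctured p, InPuncturedChartBall p ε' x →
      ∀ (v : TangentSpace (𝓡 4) x) (c : EuclideanSpace ℝ (Fin 4)),
        inner ℝ (fderiv ℝ inversion (extChartAt (𝓡 4) p x.1 - extChartAt (𝓡 4) p p)
          (mfderiv (𝓡 4) 𝓘(ℝ, EuclideanSpace ℝ (Fin 4))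
            (fun z : punctured p => extChartAt (𝓡 4) p z.1) x (J x v))) c
        = stdSymplecticForm (fderiv ℝ inversion (extChartAt (𝓡 4) p x.1 - extChartAt (𝓡 4) p p)
          (mfderiv (𝓡 4) 𝓘(ℝ, EuclideanSpace ℝ (Fin 4))
            (fun z : punctured p => extChartAt (𝓡 4) p z.1) x v)) c) :
    AnalyticAt ℂ (update (fun η : ℂ => (pencilCoord p (u η⁻¹)).1 - η⁻¹) 0 0) 0 := by
  have hd : ∀ᶠ ξ in cocompact ℂ, DifferentiableAt ℂ (fun ζ => (pencilCoord p (u ζ)).1 - ζ) ξ := by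
    filter_upwards [hu.eventually_differentiableAt_pencilCoord hε' hstd] with ξ hξ
    exact hξ.fst.sub differentiableAt_id
  exact analyticAt_update_comp_inv hd hu.2.2.2.2.1

/-- **Removable singularity of a member at infinity, `w`-coordinate**: `η ↦ w(u(η⁻¹))`, extended
by the intercept `b`, is analytic at `η = 0`. [folklore] -/
theorem IsPencilPlane.analyticAt_snd_pencilCoord_inv (hu : IsPencilPlane J u b) (hε' : 0 < ε')
    (hstd : ∀ x : punctured p, InPuncturedChartBall p ε' x →
      ∀ (v : TangentSpace (𝓡 4) x) (c : EuclideanSpace ℝ (Fin 4)),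
        inner ℝ (fderiv ℝ inversion (extChartAt (𝓡 4) p x.1 - extChartAt (𝓡 4) p p)
          (mfderiv (𝓡 4) 𝓘(ℝ, EuclideanSpace ℝ (Fin 4))
            (fun z : punctured p => extChartAt (𝓡 4) p z.1) x (J x v))) c
        = stdSymplecticForm (fderiv ℝ inversion (extChartAt (𝓡 4) p x.1 - extChartAt (𝓡 4) p p)
          (mfderiv (𝓡 4) 𝓘(ℝ, EuclideanSpace ℝ (Fin 4))
            (fun z : punctured p => extChartAt (𝓡 4) p z.1) x v)) c) :
    AnalyticAt ℂ (update (fun η : ℂ => (pencilCoord p (u η⁻¹)).2) 0 b) 0 := by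
  have hd : ∀ᶠ ξ in cocompact ℂ, DifferentiableAt ℂ (fun ζ => (pencilCoord p (u ζ)).2) ξ := by
    filter_upwards [hu.eventually_differentiableAt_pencilCoord hε' hstd] with ξ hξ
    exact hξ.snd
  exact analyticAt_update_comp_inv hd hu.2.2.2.2.2

/-- **Decay of a member at infinity** (step L2, quantitative form): `‖z(u ξ) − ξ‖ ≤ C/‖ξ‖` and
`‖w(u ξ) − b‖ ≤ C/‖ξ‖` for `‖ξ‖ ≥ R`; i.e. `z = ξ + O(1/ξ)`, `w = b + O(1/ξ)`, which in the chart
`(1/z, w/z)` at the point `q_a` of the line at infinity says that the compactified member passes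
through `q_a` with tangent direction `(1, b)`. [folklore] -/
theorem IsPencilPlane.exists_decay (hu : IsPencilPlane J u b) (hε' : 0 < ε')
    (hstd : ∀ x : punctured p, InPuncturedChartBall p ε' x →
      ∀ (v : TangentSpace (𝓡 4) x) (c : EuclideanSpace ℝ (Fin 4)),
        inner ℝ (fderiv ℝ inversion (extChartAt (𝓡 4) p x.1 - extChartAt (𝓡 4) p p)
          (mfderiv (𝓡 4) 𝓘(ℝ, EuclideanSpace ℝ (Fin 4))
            (fun z : punctured p => extChartAt (𝓡 4) p z.1) x (J x v))) c
        = stdSymplecticForm (fderiv ℝ inversion (extChartAt (𝓡 4) p x.1 - extChartAt (𝓡 4) p p)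
          (mfderiv (𝓡 4) 𝓘(ℝ, EuclideanSpace ℝ (Fin 4))
            (fun z : punctured p => extChartAt (𝓡 4) p z.1) x v)) c) :
    ∃ R C : ℝ, 0 < R ∧ 0 ≤ C ∧ ∀ ξ : ℂ, R ≤ ‖ξ‖ →
      ‖(pencilCoord p (u ξ)).1 - ξ‖ ≤ C / ‖ξ‖ ∧ ‖(pencilCoord p (u ξ)).2 - b‖ ≤ C / ‖ξ‖ := by
  have hdiff := hu.eventually_differentiableAt_pencilCoord hε' hstd
  have hd1 : ∀ᶠ ξ in cocompact ℂ, DifferentiableAt ℂ (fun ζ => (pencilCoord p (u ζ)).1 - ζ) ξ := by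
    filter_upwards [hdiff] with ξ hξ
    exact hξ.fst.sub differentiableAt_id
  have hd2 : ∀ᶠ ξ in cocompact ℂ, DifferentiableAt ℂ (fun ζ => (pencilCoord p (u ζ)).2) ξ := by
    filter_upwards [hdiff] with ξ hξ
    exact hξ.snd
  obtain ⟨R₁, C₁, hR₁, hC₁, h1⟩ := exists_norm_sub_le_div_norm hd1 hu.2.2.2.2.1
  obtain ⟨R₂, C₂, hR₂, hC₂, h2⟩ := exists_norm_sub_le_div_norm hd2 hu.2.2.2.2.2
  refine ⟨max R₁ R₂, max C₁ C₂, lt_max_of_lt_left hR₁, le_max_of_le_left hC₁, fun ξ hξ => ?_⟩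
  have hξpos : 0 < ‖ξ‖ := lt_of_lt_of_le hR₁ ((le_max_left _ _).trans hξ)
  have e1 := h1 ξ ((le_max_left _ _).trans hξ)
  have e2 := h2 ξ ((le_max_right _ _).trans hξ)
  rw [sub_zero] at e1
  exact ⟨e1.trans (div_le_div_of_nonneg_right (le_max_left _ _) hξpos.le),
    e2.trans (div_le_div_of_nonneg_right (le_max_right _ _) hξpos.le)⟩

omit [IsManifold (𝓡 4) ∞ M] [CompactSpace M] in
/-- The `z`-coordinate of a member tends to infinity at infinity (`z(u ξ) − ξ → 0`). [folklore] -/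
theorem IsPencilPlane.tendsto_fst_pencilCoord_cocompact (hu : IsPencilPlane J u b) :
    Tendsto (fun ξ => (pencilCoord p (u ξ)).1) (cocompact ℂ) (cocompact ℂ) := by
  have h : ∀ᶠ ξ in cocompact ℂ, ‖(pencilCoord p (u ξ)).1 - ξ‖ < 1 := by
    have := hu.2.2.2.2.1 (Metric.ball_mem_nhds (0 : ℂ) one_pos)
    filter_upwards [this] with ξ hξ
    simpa using hξ
  have h1 : ∀ᶠ ξ in cocompact ℂ, ‖ξ‖ + (-1) ≤ ‖(pencilCoord p (u ξ)).1‖ := by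
    filter_upwards [h] with ξ hξ
    have := norm_sub_norm_le ξ (pencilCoord p (u ξ)).1
    rw [← norm_neg, neg_sub] at hξ
    linarith
  have h2 : Tendsto (fun ξ : ℂ => ‖ξ‖ + (-1)) (cocompact ℂ) atTop :=
    tendsto_atTop_add_const_right _ _ tendsto_norm_cocompact_atTop
  have h3 : Tendsto (fun ξ => ‖(pencilCoord p (u ξ)).1‖) (cocompact ℂ) atTop :=
    tendsto_atTop_mono' _ h1 h2
  rw [← Metric.cobounded_eq_cocompact (α := ℂ)] at h3 ⊢
  exact tendsto_norm_atTop_iff_cobounded.1 h3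

end Members

end Literature.Geometry.Symplectic
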